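import Mathlib
import Summits.Ventures.PercRepro.TriangleCapStar
import Summits.Ventures.PercRepro.TriangleCapStarMatch

/-!
# PercRepro — the competitor below the threshold: `K_{2,t+1}` plus pendant edges beats the star value by
exactly one at `2k + t + 2 = t² + 6`, so the threshold of TriangleCapRowGeneral is sharp (p3, gen 31; part 11)

* `bipPend k t : SimpleGraph (Fin k)` — the complete bipartite graph `K_{2,t+1}` on `{0, 1} ∪ {2, …, t + 2}`
  plus the pendant edges `{0, v}` for `v ≥ t + 3` (the census's `(8, 11) 30` at `t = 4`);
* `k4mFree_bipPend` — a `4`-set carries `≤ 2·|S ∩ {0}|·|S ∩ [2, k)| + 2·|S ∩ {1}|·|S ∩ [2, t + 2]| ≤ 8` ordered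
  adjacent pairs;
* the degrees (`k ≥ t + 3`): `k − 2` at `0`, `t + 1` at `1`, `2` on `[2, t + 2]`, `1` beyond;
  `cherries_bipPend = C(k − 2, 2) + C(t + 1, 2) + (t + 1)`, `card_edges_bipPend` (`#E + 1 = k + t`);
* **`exists_k4mFree_cherries_eq_star_add_one`** — for `t ≥ 4` and `2k + t + 2 = t² + 6` (one below the
  threshold `t² + 6 ≤ 2k + t`) a `K₄⁻`-free graph on `Fin k` with `k − 1 + t` edges and `C(k − 1, 2) + 2t + 1`
  cherries: the bound `C(k − 1, 2) + 2t` of `cherries_le_choose_two_add_two_mul_of_k4mFree` fails there, so its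
  threshold cannot be lowered.

Axioms: standard.
-/

namespace PercRepro

namespace TriangleCap

namespace C047

open Finset

/-- `K_{2,t+1}` on `{0, 1} ∪ {2, …, t + 2}` plus the pendant edges `{0, v}`, `v ≥ t + 3`, on `Fin k`. -/
def bipPend (k t : ℕ) : SimpleGraph (Fin k) where
  Adj i j := (i.val = 0 ∧ 2 ≤ j.val) ∨ (j.val = 0 ∧ 2 ≤ i.val) ∨
    (i.val = 1 ∧ 2 ≤ j.val ∧ j.val ≤ t + 2) ∨ (j.val = 1 ∧ 2 ≤ i.val ∧ i.val ≤ t + 2)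
  symm := ⟨fun i j h => by
    rcases h with ⟨h1, h2⟩ | ⟨h1, h2⟩ | ⟨h1, h2, h3⟩ | ⟨h1, h2, h3⟩
    · exact Or.inr (Or.inl ⟨h1, h2⟩)
    · exact Or.inl ⟨h1, h2⟩
    · exact Or.inr (Or.inr (Or.inr ⟨h1, h2, h3⟩))
    · exact Or.inr (Or.inr (Or.inl ⟨h1, h2, h3⟩))⟩
  loopless := ⟨fun i h => by
    rcases h with ⟨h1, h2⟩ | ⟨h1, h2⟩ | ⟨h1, h2, _⟩ | ⟨h1, h2, _⟩ <;> omega⟩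

/-- Adjacency in `bipPend k t` is decidable. -/
instance decidableRelBipPend (k t : ℕ) : DecidableRel (bipPend k t).Adj :=
  fun i j => inferInstanceAs (Decidable ((i.val = 0 ∧ 2 ≤ j.val) ∨ (j.val = 0 ∧ 2 ≤ i.val) ∨
    (i.val = 1 ∧ 2 ≤ j.val ∧ j.val ≤ t + 2) ∨ (j.val = 1 ∧ 2 ≤ i.val ∧ i.val ≤ t + 2)))

/-- Adjacency in `bipPend k t`, unfolded. -/
theorem bipPend_adj (k t : ℕ) (i j : Fin k) :
    (bipPend k t).Adj i j ↔ (i.val = 0 ∧ 2 ≤ j.val) ∨ (j.val = 0 ∧ 2 ≤ i.val) ∨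
      (i.val = 1 ∧ 2 ≤ j.val ∧ j.val ≤ t + 2) ∨ (j.val = 1 ∧ 2 ≤ i.val ∧ i.val ≤ t + 2) := Iff.rfl

/-- The adjacent ordered pairs inside `S` pair `0` with `S ∩ [2, k)` or `1` with `S ∩ [2, t + 2]`. -/
theorem adjPairs_bipPend_le (k t : ℕ) (S : Finset (Fin k)) :
    adjPairs (bipPend k t) S ≤
      2 * ((S.filter (fun i : Fin k => i.val = 0)).card * (S.filter (fun i : Fin k => 2 ≤ i.val)).card) +
        2 * ((S.filter (fun i : Fin k => i.val = 1)).card *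
          (S.filter (fun i : Fin k => 2 ≤ i.val ∧ i.val ≤ t + 2)).card) := by
  unfold adjPairs
  set C0 := S.filter (fun i : Fin k => i.val = 0) with hC0
  set C1 := S.filter (fun i : Fin k => i.val = 1) with hC1
  set S2 := S.filter (fun i : Fin k => 2 ≤ i.val) with hS2
  set S12 := S.filter (fun i : Fin k => 2 ≤ i.val ∧ i.val ≤ t + 2) with hS12
  have hsub : (S ×ˢ S).filter (fun p => (bipPend k t).Adj p.1 p.2) ⊆
      C0 ×ˢ S2 ∪ S2 ×ˢ C0 ∪ C1 ×ˢ S12 ∪ S12 ×ˢ C1 := by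
    intro p hp
    rw [mem_filter, mem_product] at hp
    obtain ⟨⟨h1, h2⟩, hadj⟩ := hp
    rw [bipPend_adj] at hadj
    rw [mem_union, mem_union, mem_union, mem_product, mem_product, mem_product, mem_product, hC0, hC1, hS2,
      hS12, mem_filter, mem_filter, mem_filter, mem_filter, mem_filter, mem_filter, mem_filter, mem_filter]
    rcases hadj with ⟨ha, hb⟩ | ⟨ha, hb⟩ | ⟨ha, hb, hc⟩ | ⟨ha, hb, hc⟩
    · exact Or.inl (Or.inl (Or.inl ⟨⟨h1, ha⟩, ⟨h2, hb⟩⟩))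
    · exact Or.inl (Or.inl (Or.inr ⟨⟨h1, hb⟩, ⟨h2, ha⟩⟩))
    · exact Or.inl (Or.inr ⟨⟨h1, ha⟩, ⟨h2, hb, hc⟩⟩)
    · exact Or.inr ⟨⟨h1, hb, hc⟩, ⟨h2, ha⟩⟩
  calc ((S ×ˢ S).filter (fun p => (bipPend k t).Adj p.1 p.2)).card
      ≤ (C0 ×ˢ S2 ∪ S2 ×ˢ C0 ∪ C1 ×ˢ S12 ∪ S12 ×ˢ C1).card := card_le_card hsub
    _ ≤ (C0 ×ˢ S2 ∪ S2 ×ˢ C0 ∪ C1 ×ˢ S12).card + (S12 ×ˢ C1).card := card_union_le _ _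
    _ ≤ (C0 ×ˢ S2 ∪ S2 ×ˢ C0).card + (C1 ×ˢ S12).card + (S12 ×ˢ C1).card := by
        gcongr; exact card_union_le _ _
    _ ≤ (C0 ×ˢ S2).card + (S2 ×ˢ C0).card + (C1 ×ˢ S12).card + (S12 ×ˢ C1).card := by
        gcongr; exact card_union_le _ _
    _ = 2 * (C0.card * S2.card) + 2 * (C1.card * S12.card) := by
        rw [card_product, card_product, card_product, card_product]; ring

/-- **`bipPend k t` is `K₄⁻`-free.** -/
theorem k4mFree_bipPend (k t : ℕ) : K4mFree (bipPend k t) := by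
  intro S hS
  have h := adjPairs_bipPend_le k t S
  have h0 : (S.filter (fun i : Fin k => i.val = 0)).card ≤ 1 := card_filter_val_eq_le_one k 0 S
  have h1 : (S.filter (fun i : Fin k => i.val = 1)).card ≤ 1 := card_filter_val_eq_le_one k 1 S
  have h12 : (S.filter (fun i : Fin k => 2 ≤ i.val ∧ i.val ≤ t + 2)).card ≤
      (S.filter (fun i : Fin k => 2 ≤ i.val)).card := by
    apply card_le_card
    intro i hi
    rw [mem_filter] at hi ⊢
    exact ⟨hi.1, hi.2.1⟩
  have hsum : (S.filter (fun i : Fin k => i.val = 0)).card + (S.filter (fun i : Fin k => i.val = 1)).card +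
      (S.filter (fun i : Fin k => 2 ≤ i.val)).card = 4 := by
    have e1 := card_filter_add_card_filter_not (s := S) (fun i : Fin k => i.val = 0)
    have e2 := card_filter_add_card_filter_not (s := S.filter (fun i : Fin k => ¬ i.val = 0))
      (fun i : Fin k => i.val = 1)
    rw [filter_filter, filter_filter] at e2
    have e3 : S.filter (fun i : Fin k => ¬ i.val = 0 ∧ i.val = 1) = S.filter (fun i : Fin k => i.val = 1) := by
      apply filter_congr
      intro i _
      constructor
      · exact fun h => h.2
      · exact fun h => ⟨by omega, h⟩
    have e4 : S.filter (fun i : Fin k => ¬ i.val = 0 ∧ ¬ i.val = 1) =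
        S.filter (fun i : Fin k => 2 ≤ i.val) := by
      apply filter_congr
      intro i _
      constructor
      · exact fun h => by omega
      · exact fun h => ⟨by omega, by omega⟩
    rw [e3, e4] at e2
    rw [hS] at e1
    omega
  set x0 := (S.filter (fun i : Fin k => i.val = 0)).card with hx0
  set x1 := (S.filter (fun i : Fin k => i.val = 1)).card with hx1
  set y := (S.filter (fun i : Fin k => 2 ≤ i.val)).card with hy
  set y' := (S.filter (fun i : Fin k => 2 ≤ i.val ∧ i.val ≤ t + 2)).card with hy'
  clear_value x0 x1 y y'
  interval_cases x0 <;> interval_cases x1 <;> omega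

/-- The neighbours of `0` are the vertices `≥ 2`. -/
theorem filter_adj_bipPend_zero (k t : ℕ) (c : Fin k) (hc : c.val = 0) :
    univ.filter (fun x => (bipPend k t).Adj c x) = univ.filter (fun x : Fin k => 2 ≤ x.val) := by
  ext x
  rw [mem_filter, mem_filter, bipPend_adj]
  simp only [mem_univ, true_and]
  omega

/-- The neighbours of `1` are the vertices of `[2, t + 2]`. -/
theorem filter_adj_bipPend_one (k t : ℕ) (c : Fin k) (hc : c.val = 1) :
    univ.filter (fun x => (bipPend k t).Adj c x) =
      univ.filter (fun x : Fin k => 2 ≤ x.val ∧ x.val ≤ t + 2) := by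
  ext x
  rw [mem_filter, mem_filter, bipPend_adj]
  simp only [mem_univ, true_and]
  omega

/-- `#{x : Fin k | a ≤ x.val}` for `a ≤ k`. -/
theorem card_filter_le_val (k a : ℕ) (ha : a ≤ k) :
    (univ.filter (fun x : Fin k => a ≤ x.val)).card = k - a := by
  have h := card_filter_add_card_filter_not (s := (univ : Finset (Fin k))) (fun x : Fin k => a ≤ x.val)
  have h2 : (univ.filter (fun x : Fin k => ¬ a ≤ x.val)).card = a := by
    have := Fin.card_filter_val_lt (n := k) (m := a)
    rw [show (univ.filter (fun x : Fin k => ¬ a ≤ x.val)) = univ.filter (fun x : Fin k => x.val < a) from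
      filter_congr (fun x _ => by omega)]
    rw [this]
    omega
  rw [card_univ, Fintype.card_fin] at h
  omega

/-- `#{x : Fin k | a ≤ x.val ≤ b}` for `a ≤ b + 1 ≤ k`. -/
theorem card_filter_val_between (k a b : ℕ) (hab : a ≤ b + 1) (hb : b + 1 ≤ k) :
    (univ.filter (fun x : Fin k => a ≤ x.val ∧ x.val ≤ b)).card = b + 1 - a := by
  have h := card_filter_add_card_filter_not (s := univ.filter (fun x : Fin k => a ≤ x.val))
    (fun x : Fin k => x.val ≤ b)
  rw [filter_filter, filter_filter, card_filter_le_val k a (by omega)] at h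
  have e : (univ.filter (fun x : Fin k => a ≤ x.val ∧ ¬ x.val ≤ b)) =
      univ.filter (fun x : Fin k => b + 1 ≤ x.val) :=
    filter_congr (fun x _ => by omega)
  rw [e, card_filter_le_val k (b + 1) hb] at h
  omega

/-- The degree of `0` is `k − 2` (`k ≥ 2`). -/
theorem deg_bipPend_zero (k t : ℕ) (hk : 2 ≤ k) (c : Fin k) (hc : c.val = 0) : deg (bipPend k t) c = k - 2 := by
  unfold deg
  rw [filter_adj_bipPend_zero k t c hc, card_filter_le_val k 2 hk]

/-- The degree of `1` is `t + 1` (`k ≥ t + 3`). -/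
theorem deg_bipPend_one (k t : ℕ) (hk : t + 3 ≤ k) (c : Fin k) (hc : c.val = 1) :
    deg (bipPend k t) c = t + 1 := by
  unfold deg
  rw [filter_adj_bipPend_one k t c hc, card_filter_val_between k 2 (t + 2) (by omega) (by omega)]
  omega

/-- The neighbours of a middle vertex `2 ≤ v ≤ t + 2` are `0` and `1` (`k ≥ 2`). -/
theorem filter_adj_bipPend_middle (k t : ℕ) (hk : 2 ≤ k) (v : Fin k) (hv2 : 2 ≤ v.val) (hvt : v.val ≤ t + 2) :
    univ.filter (fun x => (bipPend k t).Adj v x) = {(⟨0, by omega⟩ : Fin k), ⟨1, by omega⟩} := by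
  ext x
  rw [mem_filter, bipPend_adj, mem_insert, mem_singleton, Fin.ext_iff, Fin.ext_iff]
  simp only [mem_univ, true_and]
  omega

/-- A middle vertex has degree `2`. -/
theorem deg_bipPend_middle (k t : ℕ) (hk : 2 ≤ k) (v : Fin k) (hv2 : 2 ≤ v.val) (hvt : v.val ≤ t + 2) :
    deg (bipPend k t) v = 2 := by
  unfold deg
  rw [filter_adj_bipPend_middle k t hk v hv2 hvt, card_pair]
  rw [Ne, Fin.ext_iff]
  simp

/-- The neighbours of a pendant vertex `v ≥ t + 3` are `{0}`. -/
theorem filter_adj_bipPend_far (k t : ℕ) (v : Fin k) (hv : t + 3 ≤ v.val) :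
    univ.filter (fun x => (bipPend k t).Adj v x) = {(⟨0, by omega⟩ : Fin k)} := by
  ext x
  rw [mem_filter, bipPend_adj, mem_singleton, Fin.ext_iff]
  simp only [mem_univ, true_and]
  omega

/-- A pendant vertex has degree `1`. -/
theorem deg_bipPend_far (k t : ℕ) (v : Fin k) (hv : t + 3 ≤ v.val) : deg (bipPend k t) v = 1 := by
  unfold deg
  rw [filter_adj_bipPend_far k t v hv, card_singleton]

/-- The degree of every vertex of `bipPend k t` (`k ≥ t + 3`), as a function of its value. -/
theorem deg_bipPend (k t : ℕ) (hk : t + 3 ≤ k) (v : Fin k) :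
    deg (bipPend k t) v =
      if v.val = 0 then k - 2 else if v.val = 1 then t + 1 else if v.val ≤ t + 2 then 2 else 1 := by
  split_ifs with h0 h1 h2
  · exact deg_bipPend_zero k t (by omega) v h0
  · exact deg_bipPend_one k t hk v h1
  · exact deg_bipPend_middle k t (by omega) v (by omega) h2
  · exact deg_bipPend_far k t v (by omega)

/-- `Σ_v C(d(v), 2) = C(k − 2, 2) + C(t + 1, 2) + (t + 1)` on `bipPend k t` (`k ≥ t + 3`). -/
theorem cherries_bipPend (k t : ℕ) (hk : t + 3 ≤ k) :
    cherries (bipPend k t) = (k - 2).choose 2 + (t + 1).choose 2 + (t + 1) := by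
  unfold cherries
  rw [sum_congr rfl (fun v _ => by rw [deg_bipPend k t hk v])]
  rw [Fin.sum_univ_eq_sum_range
    (fun i => (if i = 0 then k - 2 else if i = 1 then t + 1 else if i ≤ t + 2 then 2 else 1).choose 2) k]
  obtain ⟨j, rfl⟩ : ∃ j, k = t + 3 + j := ⟨k - (t + 3), by omega⟩
  rw [sum_range_add, sum_range_succ', sum_range_succ']
  have hrest : ∑ x ∈ range j, (if t + 3 + x = 0 then t + 3 + j - 2 else if t + 3 + x = 1 then t + 1
      else if t + 3 + x ≤ t + 2 then 2 else 1).choose 2 = 0 := by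
    apply sum_eq_zero
    intro x _
    rw [if_neg (by omega), if_neg (by omega), if_neg (by omega)]
    rfl
  have hmid : ∑ x ∈ range (t + 1), (if x + 1 + 1 = 0 then t + 3 + j - 2 else if x + 1 + 1 = 1 then t + 1
      else if x + 1 + 1 ≤ t + 2 then 2 else 1).choose 2 = t + 1 := by
    have h1 : ∀ x ∈ range (t + 1), (if x + 1 + 1 = 0 then t + 3 + j - 2 else if x + 1 + 1 = 1 then t + 1
        else if x + 1 + 1 ≤ t + 2 then 2 else 1).choose 2 = 1 := by
      intro x hx
      rw [mem_range] at hx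
      rw [if_neg (by omega), if_neg (by omega), if_pos (by omega)]
      rfl
    rw [sum_congr rfl h1, sum_const, card_range, smul_eq_mul, mul_one]
  rw [hrest, hmid, if_pos rfl, if_neg (by omega), if_pos rfl]
  omega

/-- `Σ_v d(v) + 2 = 2k + 2t` on `bipPend k t` (`k ≥ t + 3`). -/
theorem sum_deg_bipPend (k t : ℕ) (hk : t + 3 ≤ k) : ∑ v, deg (bipPend k t) v + 2 = 2 * k + 2 * t := by
  rw [sum_congr rfl (fun v _ => by rw [deg_bipPend k t hk v])]
  rw [Fin.sum_univ_eq_sum_range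
    (fun i => if i = 0 then k - 2 else if i = 1 then t + 1 else if i ≤ t + 2 then 2 else 1) k]
  obtain ⟨j, rfl⟩ : ∃ j, k = t + 3 + j := ⟨k - (t + 3), by omega⟩
  rw [sum_range_add, sum_range_succ', sum_range_succ']
  have hrest : ∑ x ∈ range j, (if t + 3 + x = 0 then t + 3 + j - 2 else if t + 3 + x = 1 then t + 1
      else if t + 3 + x ≤ t + 2 then 2 else 1) = j := by
    rw [sum_congr rfl (fun x _ => by rw [if_neg (by omega), if_neg (by omega), if_neg (by omega)])]
    rw [sum_const, card_range, smul_eq_mul, mul_one]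
  have hmid : ∑ x ∈ range (t + 1), (if x + 1 + 1 = 0 then t + 3 + j - 2 else if x + 1 + 1 = 1 then t + 1
      else if x + 1 + 1 ≤ t + 2 then 2 else 1) = 2 * (t + 1) := by
    have h1 : ∀ x ∈ range (t + 1), (if x + 1 + 1 = 0 then t + 3 + j - 2 else if x + 1 + 1 = 1 then t + 1
        else if x + 1 + 1 ≤ t + 2 then 2 else 1) = 2 := by
      intro x hx
      rw [mem_range] at hx
      rw [if_neg (by omega), if_neg (by omega), if_pos (by omega)]
    rw [sum_congr rfl h1, sum_const, card_range, smul_eq_mul, mul_comm]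
  rw [hrest, hmid, if_pos rfl, if_neg (by omega), if_pos rfl]
  omega

/-- `bipPend k t` has `k − 1 + t` edges (handshake; `k ≥ t + 3`). -/
theorem card_edges_bipPend (k t : ℕ) (hk : t + 3 ≤ k) : (bipPend k t).edgeFinset.card + 1 = k + t := by
  have h := sum_deg_eq (bipPend k t)
  have h2 := sum_deg_bipPend k t hk
  omega

/-- The cherries of `bipPend k t` exceed the star value by exactly `(t² − t + 6)/2 − k`: at
`2k + t + 2 = t² + 6` (one below the threshold) by exactly one. -/
theorem cherries_bipPend_eq_star_add_one (k t : ℕ) (ht : 4 ≤ t) (hk : 2 * k + t + 2 = t * t + 6) :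
    cherries (bipPend k t) = (k - 1).choose 2 + 2 * t + 1 := by
  have hk3 : t + 3 ≤ k := by nlinarith [hk]
  rw [cherries_bipPend k t hk3]
  obtain ⟨K, rfl⟩ : ∃ K, k = K + 2 := ⟨k - 2, by omega⟩
  rw [Nat.add_sub_cancel, show K + 2 - 1 = K + 1 from by omega]
  have h1 := two_mul_choose_two_add K
  have h2 := two_mul_choose_two_add (K + 1)
  have h3 := two_mul_choose_two_add (t + 1)
  nlinarith [h1, h2, h3, hk]

/-- **THE THRESHOLD IS SHARP:** for `t ≥ 4` and `2k + t + 2 = t² + 6` a `K₄⁻`-free graph on `Fin k` with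
`k − 1 + t` edges and `C(k − 1, 2) + 2t + 1` cherries — one more than the bound of
`cherries_le_choose_two_add_two_mul_of_k4mFree`, which therefore needs `t² + 6 ≤ 2k + t`. -/
theorem exists_k4mFree_cherries_eq_star_add_one (k t : ℕ) (ht : 4 ≤ t) (hk : 2 * k + t + 2 = t * t + 6) :
    ∃ (D : SimpleGraph (Fin k)) (_ : DecidableRel D.Adj),
      K4mFree D ∧ D.edgeFinset.card + 1 = k + t ∧ cherries D = (k - 1).choose 2 + 2 * t + 1 :=
  ⟨bipPend k t, inferInstance, k4mFree_bipPend k t, card_edges_bipPend k t (by nlinarith [hk]),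
    cherries_bipPend_eq_star_add_one k t ht hk⟩

/-- The census row `(8, 11) 30` is `bipPend 8 4` (`t = 4`, one below the threshold `k = 9`). -/
theorem cherries_bipPend_eight_four : cherries (bipPend 8 4) = 30 := by
  rw [cherries_bipPend 8 4 (by norm_num)]
  decide

end C047

end TriangleCap

end PercRepro
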